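import Literature.NumberTheory.DiophantineGeometry.GeneralizedFermatTwoPowerCoefficientGoodReductionProofs
import Literature.NumberTheory.DiophantineGeometry.MinimalDiscriminantRingOfIntegersProofs
import Literature.NumberTheory.EllipticCurves.MultiplicativeUnramifiedTorsionProofs
import Literature.NumberTheory.EllipticCurves.RootNumberTwistProofs
import Literature.NumberTheory.EllipticCurves.HasseWeilAbelianConductorSaitoLeafProofs
import HarnessLib

/-!
# Ribet 1997, Theorem 3 along Serre's road: the Tate-curve hypothesis is a theorem (proofs)

Topic `Literature/NumberTheory/DiophantineGeometry`; seventh sibling *proofs* file (theorems only: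
no definition, no named fact, no `sorry`) of `GeneralizedFermatTwoPowerCoefficient` (named fact
`ribet1997_twoPowerFermat`: K. Ribet, *On the equation `aᵖ + 2^α bᵖ + cᵖ = 0`*, Acta Arith. 79
(1997), Thm. 3).  The sibling `…GoodReductionProofs` proved
`ribet1997_twoPowerFermat_of_khare_wintenberger_of_mazurKenku_of_tateCurve`: Theorem 3 from the
three named facts `khare_wintenberger`, `mazurKenku_exists_cyclic_isogeny`,
`artinConductorExponent_tate_eq_conductorExponent_of_isElliptic`, Serre's weight-`2` statement
`hwt` (Serre 1987, §2.9 Prop. 5 / (4.1.11)) and the printed Tate-curve statement `hTate` — *a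
multiplicative prime `ℓ ≠ p` with `p ∣ ord_ℓ Δ_min` does not divide `N(ρ̄_{E,p})`* (Serre,
Invent. Math. 15 (1972), n° 1.12; Serre 1987, (4.1.12): "`N(ρ) = ∏ ℓ`, `ℓ ≠ p`, `p ∤ v_ℓ(Δ)`",
computed "en utilisant le modèle de Tate"; Diamond–Darmon–Taylor, Prop. 2.12(c)).

The tree now proves the unramified half of the Tate-curve criterion without the Tate curve, from
Kodaira–Néron over `K_v^nr` (`MultiplicativeUnramifiedTorsionProofs`:
`WeierstrassCurve.smul_geomTorsion_eq_of_mem_inertia_of_hasMultiplicativeReductionAt_of_dvd` — at a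
multiplicative place `v ∤ p` with `p ∣ ord_v(Δ_min)` the inertia groups act trivially on `E[p]`).
This file turns it into the statement `hTate` and **discharges that hypothesis**:

* `WeierstrassCurve.IsTorsionGaloisRep.isUnramifiedAt_of_hasMultiplicativeReductionAt_of_dvd` —
  the framed mod-`p` representation `ρ̄_{E,p}` of an elliptic curve over a number field is
  unramified at every multiplicative `v ∤ p` with `p ∣ ord_v(Δ_min)` (the multiplicative analogue of
  `IsTorsionGaloisRep.isUnramifiedAt_of_hasGoodReductionAt`, Néron–Ogg–Shafarevich);
* `not_dvd_serreLevel_baseChange_of_hasMultiplicativeReductionAt_of_dvd` (places of `𝓞 ℚ`) and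
  `…_int` (places of `ℤ`) — such a prime does not divide Serre's level `N(ρ̄_{E,p} ⊗ k)`;
* `ribet1997_twoPowerFermat_of_khare_wintenberger_of_mazurKenku_of_serreWeightTwo` — **Theorem 3
  from the three named facts and `hwt` alone**; and
  `ribet1997_twoPowerFermat_of_khare_wintenberger_of_mazurKenku_of_saito_of_serreWeightTwo` — the
  same with the Ogg–Saito fact replaced by its one remaining leaf, Saito's `p = 2` theorem
  `WeierstrassCurve.swanConductorAt_rationalTate_eq_wildConductorExponent_of_ringChar_eq_two`
  (`HasseWeilAbelianConductorSaitoLeafProofs`).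

After this file the discharge `ribet1997_twoPowerFermat_holds` is the last theorem applied to
`khare_wintenberger_holds` (SIZE XL, Khare–Wintenberger–Kisin), `mazurKenku_exists_cyclic_isogeny_holds`
(XL, Mazur 1978 + Kenku), `artinConductorExponent_tate_eq_conductorExponent_of_isElliptic_holds`
(Ogg–Saito exponentwise; proved in the tree for semistable curves, needed here at the additive
place `2` of the Frey curve) and to a discharge of Serre's §2.9 Prop. 5 (weight `2` of `E[p]` at a
semistable `p ≥ 5` with `p ∣ ord_p Δ_min`: finite flatness / "peu ramifié", Serre 1987 (4.1.11)),
which is not catalogued as a named fact.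

## References

* [Ribet1997] K. A. Ribet, Acta Arith. 79 (1997), 7–16, Thm. 3, §§2–3.
* [Serre1987] J.-P. Serre, Duke Math. J. 54 (1987): §1.2, §2.9 Prop. 5, §4.1 (4.1.11)–(4.1.12).
* [SerreInventiones1972] J.-P. Serre, Invent. Math. 15 (1972), n° 1.12 (courbes de Tate).
* [DarmonDiamondTaylor1995] H. Darmon, F. Diamond, R. Taylor, *Fermat's Last Theorem*, Prop. 2.12.
* [SilvermanATAEC1994] J. H. Silverman, *Advanced Topics in the Arithmetic of Elliptic Curves*,
  Cor. IV.9.2(d), V.4–V.5, Exercise 5.13(b); Thm. IV.11.1 (Ogg's formula, PDF pp. 365–366).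
* [Saito1988] T. Saito, Duke Math. J. 57 (1988), Theorem 1.
-/

noncomputable section

open scoped NumberField
open IsDedekindDomain Rat.HeightOneSpectrum

universe u


namespace WeierstrassCurve

open Literature.NumberTheory.GaloisRepresentations Literature.NumberTheory.EllipticCurves Field
  IsDedekindDomain

/-- **`E[p]` is unramified at a multiplicative place `v ∤ p` with `p ∣ ord_v(Δ_min)`, framed
form** (Serre, Invent. Math. 15 (1972), n° 1.12; Serre 1987, (4.1.12); Diamond–Darmon–Taylor,
Prop. 2.12(c)): for an elliptic curve `E` over a number field `K`, a place `v ∤ p` of multiplicative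
reduction with `p ∣ ord_v(Δ_min)` and any framed `ρ̄ : Γ_K →ₜ* GL₂(ℤ/p)` with
`W.IsTorsionGaloisRep p ρ̄`, `ρ̄` is unramified at `v` (`FramedGaloisRep.IsUnramifiedAt`: every
inertia group `I_𝔓`, `𝔓 ∣ v`, maps to `1`).  From the tree theorem
`smul_geomTorsion_eq_of_mem_inertia_of_hasMultiplicativeReductionAt_of_dvd`
(`MultiplicativeUnramifiedTorsionProofs`, Kodaira–Néron over `K_v^nr`), as the good-reduction
analogue `IsTorsionGaloisRep.isUnramifiedAt_of_hasGoodReductionAt`.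
[cite: SerreInventiones1972, n° 1.12] [cite: Serre1987, §4.1 (4.1.12)] [cite: DarmonDiamondTaylor1995, Prop. 2.12] -/
theorem IsTorsionGaloisRep.isUnramifiedAt_of_hasMultiplicativeReductionAt_of_dvd {K : Type u}
    [Field K] [NumberField K] {W : WeierstrassCurve K} [W.IsElliptic] {p : ℕ}
    {ρ : FramedGaloisRep K (ZMod p) 2} (hρ : W.IsTorsionGaloisRep p ρ)
    {v : HeightOneSpectrum (𝓞 K)} (hmult : W.HasMultiplicativeReductionAt v) (hp : p.Prime)
    (hpv : (p : 𝓞 K) ∉ v.asIdeal) (hdvd : p ∣ W.ordMinimalDiscriminant v) :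
    ρ.IsUnramifiedAt v := by
  intro 𝔓 h𝔓 τ hτ
  refine hρ.eq_one_of_forall_smul_eq fun P ↦ ?_
  exact W.smul_geomTorsion_eq_of_mem_inertia_of_hasMultiplicativeReductionAt_of_dvd hmult hp hpv
    hdvd h𝔓 hτ P

end WeierstrassCurve

namespace Literature.NumberTheory.DiophantineGeometry

open WeierstrassCurve GaloisRepresentations EllipticCurves GaloisRepresentations.ModPGaloisRep
  GaloisRepresentations.IsNonarchimedeanLocalField ValuativeRel IsDedekindDomain.HeightOneSpectrum
  Literature.NumberTheory.Automorphic Literature.NumberTheory.Automorphic.BCDT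
  IsDedekindDomain Rat.HeightOneSpectrum

/-- **Tate curve for Serre's level: a multiplicative prime `ℓ ≠ p` with `p ∣ ord_ℓ(Δ_min)` does
not divide `N(ρ̄_{E,p} ⊗ k)`.**  For an elliptic curve `W/ℚ`, a prime `p`, a framed model `ρ̄` of
`E[p]` (`IsTorsionGaloisRep`), a ring homomorphism `j : 𝔽_p → k` to a topological field and a
finite place `v ∤ p` of `ℚ` of multiplicative reduction with `p ∣ ord_v(Δ_min)`, `ℓ_v ∤ N(ρ̄ ⊗_j k)`:
`E[p]` is unramified at `v` (`IsTorsionGaloisRep.isUnramifiedAt_of_hasMultiplicativeReductionAt_of_dvd`),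
so is `ρ̄ ⊗ k` (`isUnramifiedAt_baseChange_iff`), hence `a_v(ρ̄ ⊗ k) = 0` (Serre, *Local Fields*,
VI §2) and `ℓ_v ∤ N` (`not_dvd_serreLevel_of_artinConductorExponent_eq_zero`).  This is the
multiplicative half of Serre 1987, (4.1.12) ("`N(ρ) = ∏ ℓ` over the `ℓ ≠ p` with
`p ∤ v_ℓ(Δ)`", computed there "en utilisant le modèle de Tate").
[cite: Serre1987, §4.1 (4.1.12)] [cite: SerreInventiones1972, n° 1.12] -/
theorem not_dvd_serreLevel_baseChange_of_hasMultiplicativeReductionAt_of_dvd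
    (W : WeierstrassCurve ℚ) [W.IsElliptic] (p : ℕ) [Fact p.Prime]
    {ρ : ModPGaloisRep ℚ (ZMod p) 2} (hρ : W.IsTorsionGaloisRep p ρ)
    {k : Type*} [Field k] [TopologicalSpace k] [IsTopologicalRing k] (j : ZMod p →+* k)
    (hj : Continuous j) (v : HeightOneSpectrum (𝓞 ℚ))
    (hvp : ((primesEquiv v : Nat.Primes) : ℕ) ≠ p) (hmult : W.HasMultiplicativeReductionAt v)
    (hdvd : p ∣ W.ordMinimalDiscriminant v) :
    ¬ ((primesEquiv v : Nat.Primes) : ℕ) ∣ serreLevel p (FramedRep.baseChange j hj ρ) := by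
  have hp : p.Prime := Fact.out
  have hn : ((p : ℕ) : 𝓞 ℚ) ∉ v.asIdeal :=
    fun h ↦ hvp ((natCast_mem_asIdeal_iff_primesEquiv_eq v hp).mp h)
  have hunr : FramedGaloisRep.IsUnramifiedAt v ρ :=
    hρ.isUnramifiedAt_of_hasMultiplicativeReductionAt_of_dvd hmult hp hn hdvd
  have hunr' : FramedGaloisRep.IsUnramifiedAt v (FramedRep.baseChange j hj ρ) :=
    (FramedGaloisRep.isUnramifiedAt_baseChange_iff j hj j.injective v ρ).mpr hunr
  have h0 := GaloisRep.artinConductorExponent_eq_zero_of_isUnramifiedAt_holds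
    ((FramedGaloisRep.isUnramifiedAt_toGaloisRep_iff v _).mpr hunr')
  exact not_dvd_serreLevel_of_artinConductorExponent_eq_zero p _ v h0

/-- The same over the places of `ℤ` (the indexing of `WeierstrassCurve.HasMultiplicativeReductionAt`
and `ordMinimalDiscriminant` over `ℤ ⊆ ℚ` used by the Frey-curve files): for a finite place `v` of
`ℤ` above a prime `ℓ ≠ p` of multiplicative reduction with `p ∣ ord_ℓ(Δ_min)`,
`ℓ ∤ N(ρ̄_{E,p} ⊗ k)`.  The two multiplicative-reduction predicates are compared through the
prime-indexed `HasMultiplicativeReductionAtPrime ℓ`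
(`hasMultiplicativeReductionAtPrime_iff_hasMultiplicativeReductionAt_holds` for `ℤ`,
`…_ringOfIntegers` for `𝓞 ℚ`), and `ord_v(Δ_min)` depends only on `ℓ`
(`ordMinimalDiscriminant_eq_of_primesEquiv_eq`). [cite: Serre1987, §4.1 (4.1.12)] [cite: SerreInventiones1972, n° 1.12] -/
theorem not_dvd_serreLevel_baseChange_of_hasMultiplicativeReductionAt_of_dvd_int
    (W : WeierstrassCurve ℚ) [W.IsElliptic] (p : ℕ) [Fact p.Prime]
    {ρ : ModPGaloisRep ℚ (ZMod p) 2} (hρ : W.IsTorsionGaloisRep p ρ)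
    {k : Type*} [Field k] [TopologicalSpace k] [IsTopologicalRing k] (j : ZMod p →+* k)
    (hj : Continuous j) (v : HeightOneSpectrum ℤ) (hvp : natGenerator v ≠ p)
    (hmult : W.HasMultiplicativeReductionAt v) (hdvd : p ∣ W.ordMinimalDiscriminant v) :
    ¬ natGenerator v ∣ serreLevel p (FramedRep.baseChange j hj ρ) := by
  set ℓ : Nat.Primes := primesEquiv (R := ℤ) v with hℓ_def
  have hℓv : (ℓ : ℕ) = natGenerator v := rfl
  haveI : Fact (ℓ : ℕ).Prime := ⟨ℓ.2⟩
  set v' : HeightOneSpectrum (𝓞 ℚ) := (primesEquiv (R := 𝓞 ℚ)).symm ℓ with hv'_def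
  have hℓv' : (primesEquiv (R := 𝓞 ℚ) v' : Nat.Primes) = ℓ := by
    rw [hv'_def, Equiv.apply_symm_apply]
  -- multiplicative reduction at `v` ⇒ at the prime `ℓ` ⇒ at `v'`
  have h1 : W.HasMultiplicativeReductionAtPrime (ℓ : ℕ) := by
    have h := hasMultiplicativeReductionAtPrime_iff_hasMultiplicativeReductionAt_holds W ℓ
    rw [hℓ_def, Equiv.symm_apply_apply] at h
    exact h.mpr hmult
  have h2 : W.HasMultiplicativeReductionAt v' := by
    have h := hasMultiplicativeReductionAtPrime_iff_hasMultiplicativeReductionAt_ringOfIntegers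
      (W := W) v'
    have key : ∀ (q : Nat.Primes) (hq : primesEquiv (R := 𝓞 ℚ) v' = q),
        (haveI := Fact.mk q.2; W.HasMultiplicativeReductionAtPrime (q : ℕ)) →
          W.HasMultiplicativeReductionAt v' := by
      rintro q rfl hq; exact h.mp hq
    exact key ℓ hℓv' h1
  -- `ord_v Δ_min = ord_{v'} Δ_min`: both are the exponent computed in `ℚ_ℓ`
  have h3 : W.ordMinimalDiscriminant v' = W.ordMinimalDiscriminant v := by
    let e : Nat.Primes → ℕ := fun q =>
      haveI : Fact q.1.Prime := ⟨q.2⟩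
      (IsDiscreteValuationRing.addVal ℤ_[q]
        (((W.baseChange ℚ_[q]).minimal ℤ_[q]).integralModel ℤ_[q]).Δ).toNat
    have e1 : W.ordMinimalDiscriminant v' = e (primesEquiv v') := W.ordMinimalDiscriminant_eq_padic v'
    have e2 : W.ordMinimalDiscriminant v = e (primesEquiv v) := W.ordMinimalDiscriminant_eq_padic v
    rw [e1, e2, hℓv', hℓ_def]
  have h4 := not_dvd_serreLevel_baseChange_of_hasMultiplicativeReductionAt_of_dvd W p hρ j hj v'
    (by rw [hℓv', hℓv]; exact hvp) h2 (by rw [h3]; exact hdvd)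
  rwa [hℓv', hℓv] at h4

/-- **Ribet 1997, Theorem 3, from `khare_wintenberger`, `mazurKenku_exists_cyclic_isogeny`, the
exponentwise Ogg–Saito fact and Serre's weight-`2` statement alone — the Tate-curve hypothesis
`hTate` is now a theorem.**  This is
`ribet1997_twoPowerFermat_of_khare_wintenberger_of_mazurKenku_of_tateCurve`
(`…GoodReductionProofs`) with its hypothesis `hTate` (Serre 1972, n° 1.12 / Serre 1987, (4.1.12):
a multiplicative `ℓ ≠ p` with `p ∣ ord_ℓ Δ_min` does not divide `N(ρ̄_{E,p} ⊗ k)`) **discharged** by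
`not_dvd_serreLevel_baseChange_of_hasMultiplicativeReductionAt_of_dvd_int`, i.e. by the tree's
Kodaira–Néron theory over `K_v^nr` (`MultiplicativeUnramifiedTorsionProofs`).  Remaining
hypotheses: `hKW` (named fact `khare_wintenberger`), `hMK` (named fact
`mazurKenku_exists_cyclic_isogeny`), `hOS` (named fact
`artinConductorExponent_tate_eq_conductorExponent_of_isElliptic`, Ogg–Saito exponentwise) and `hwt`
(Serre 1987, §2.9 Prop. 5 with (4.1.11): `k(ρ̄_{E,p} ⊗ k) = 2` at a semistable `p ≥ 5` with
`p ∣ ord_p Δ_min`). [cite: Ribet1997, Thm. 3, §§2–3] [cite: Serre1987, §2.9 Prop. 5, §4.1 (4.1.11)–(4.1.12)]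
[cite: SerreInventiones1972, n° 1.12] -/
theorem ribet1997_twoPowerFermat_of_khare_wintenberger_of_mazurKenku_of_serreWeightTwo
    (hKW : ∀ (p : ℕ) [Fact p.Prime] (k : Type) [Field k] [TopologicalSpace k] [DiscreteTopology k],
      khare_wintenberger p k)
    (hMK : mazurKenku_exists_cyclic_isogeny)
    (hOS : ∀ (W : WeierstrassCurve ℚ) (ℓ : ℕ) [Fact ℓ.Prime],
      W.artinConductorExponent_tate_eq_conductorExponent_of_isElliptic ℓ)
    (hwt : ∀ (W : WeierstrassCurve ℚ) [W.IsElliptic] (p : ℕ) [Fact p.Prime], 5 ≤ p →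
      W.IsSemistableAt ((primesEquiv (R := ℤ)).symm ⟨p, Fact.out⟩) →
      p ∣ W.ordMinimalDiscriminant ((primesEquiv (R := ℤ)).symm ⟨p, Fact.out⟩) →
      ∀ ρ : ModPGaloisRep ℚ (ZMod p) 2, W.IsTorsionGaloisRep p ρ →
        ∀ (k : Type) [Field k] [TopologicalSpace k] [DiscreteTopology k] [CharP k p]
          [IsAlgClosed k] (j : ZMod p →+* k)
          (loc : LocalRestrictionAt p (FramedRep.baseChange j continuous_of_discreteTopology ρ))
          (ι : absIntegers 𝒪[loc.F] loc.F ⧸ absMaximalIdeal loc.F →+* k),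
          serreWeight p (FramedRep.baseChange j continuous_of_discreteTopology ρ) loc ι = 2) :
    ribet1997_twoPowerFermat :=
  ribet1997_twoPowerFermat_of_khare_wintenberger_of_mazurKenku_of_tateCurve hKW hMK hOS hwt
    fun W _ p _ _ hρ _ _ _ _ _ _ j v hvp hmult hord ↦
      not_dvd_serreLevel_baseChange_of_hasMultiplicativeReductionAt_of_dvd_int W p hρ j _ v hvp
        hmult hord

/-- **Ribet 1997, Theorem 3, from `khare_wintenberger`, `mazurKenku_exists_cyclic_isogeny`, Saito's
`p = 2` conductor theorem and Serre's weight-`2` statement.**  The exponentwise Ogg–Saito fact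
`artinConductorExponent_tate_eq_conductorExponent_of_isElliptic W ℓ` used as `hOS` rests, after
`HasseWeilAbelianConductorSaitoLeafProofs`, on exactly one named fact of the tree: Ogg's formula for
the wild part of the conductor at the additive places of residue characteristic `2`,
`WeierstrassCurve.swanConductorAt_rationalTate_eq_wildConductorExponent_of_ringChar_eq_two W ℓ`
(Saito 1988, Thm. 1; Silverman *ATAEC* IV.11.1, case `p = 2`) — needed here at the place `2` of the
Frey curve `y² = x(x - aᵖ)(x + 2^α bᵖ)` with `ord₂(2^α bᵖ) ∈ {2, 3}`, where its reduction is
additive (types `I₁*`, `III*`, `f₂ = 3`).  So Theorem 3 follows from the named facts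
`khare_wintenberger` (Khare–Wintenberger–Kisin), `mazurKenku_exists_cyclic_isogeny` (Mazur 1978 +
Kenku), that Saito leaf (`hSaito`), and `hwt` (Serre 1987, §2.9 Prop. 5 with (4.1.11), not
catalogued). [cite: Ribet1997, Thm. 3, §§2–3] [cite: Serre1987, §2.9 Prop. 5, §4.1 (4.1.11)–(4.1.12)]
[cite: Saito1988, Theorem 1] [cite: SilvermanATAEC1994, Thm. IV.11.1 (PDF pp. 365–366)] -/
theorem ribet1997_twoPowerFermat_of_khare_wintenberger_of_mazurKenku_of_saito_of_serreWeightTwo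
    (hKW : ∀ (p : ℕ) [Fact p.Prime] (k : Type) [Field k] [TopologicalSpace k] [DiscreteTopology k],
      khare_wintenberger p k)
    (hMK : mazurKenku_exists_cyclic_isogeny)
    (hSaito : ∀ (W : WeierstrassCurve ℚ) (ℓ : ℕ) [Fact ℓ.Prime],
      W.swanConductorAt_rationalTate_eq_wildConductorExponent_of_ringChar_eq_two ℓ)
    (hwt : ∀ (W : WeierstrassCurve ℚ) [W.IsElliptic] (p : ℕ) [Fact p.Prime], 5 ≤ p →
      W.IsSemistableAt ((primesEquiv (R := ℤ)).symm ⟨p, Fact.out⟩) →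
      p ∣ W.ordMinimalDiscriminant ((primesEquiv (R := ℤ)).symm ⟨p, Fact.out⟩) →
      ∀ ρ : ModPGaloisRep ℚ (ZMod p) 2, W.IsTorsionGaloisRep p ρ →
        ∀ (k : Type) [Field k] [TopologicalSpace k] [DiscreteTopology k] [CharP k p]
          [IsAlgClosed k] (j : ZMod p →+* k)
          (loc : LocalRestrictionAt p (FramedRep.baseChange j continuous_of_discreteTopology ρ))
          (ι : absIntegers 𝒪[loc.F] loc.F ⧸ absMaximalIdeal loc.F →+* k),
          serreWeight p (FramedRep.baseChange j continuous_of_discreteTopology ρ) loc ι = 2) :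
    ribet1997_twoPowerFermat :=
  ribet1997_twoPowerFermat_of_khare_wintenberger_of_mazurKenku_of_serreWeightTwo hKW hMK
    (fun W ℓ _ ↦ W.artinConductorExponent_tate_eq_conductorExponent_of_isElliptic_of_two ℓ
      (hSaito W ℓ)) hwt

end Literature.NumberTheory.DiophantineGeometry
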